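import Summits.QuantumAdvantage.QuantumAdvantage.Theorems.WalkTwoStepTransferAutomaton

/-!
# (G♯) local engine — toward `DensePinned p`: nonexpansion for MERGING automata (shift registers) and the sign-sum form of the bias

Cell qa-qnc0, rung (G♯) = item stmt-QuantumAdvantage-23121 (planner qa-qnc0-p2 g24, ask P2-24b); prover qn-prover-3 g15.

Two more architecture-independent pieces for the dense pinned branch.
* The planner's enlarged state `ℤ_{3p} × {0,1}^{d₀}` (counter + shift register of the last `d₀` bits) is NOT injective per input bit (the
  oldest bit is forgotten), so `sumSq_stepOp_le` of `WalkTwoStepTransferAutomaton.lean` does not apply to it; what does hold is that every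
  state has at most TWO preimages among all (state, bit) pairs (the uniform measure is stationary).  `sumSq_stepOp_le_of_fiber` proves the
  `ℓ²`-nonexpansion under exactly that hypothesis (`sum_comp_le_two_mul`: a fibrewise count), with the run / pointwise / cube-sum corollaries
  `sumSq_runOps_le_of_fiber`, `abs_sum_pathVal_le_of_fiber`.
* `two_mul_card_filter_sub`: for any finite set `Q` and Boolean `f`, `2·#{f} − #Q = −Σ_{u ∈ Q} (−1)^{[f u]}` — the bias of the winners in a
  part is (minus half) the signed sum that the transfer identity evaluates (`abs_card_filter_sub_half_le`).
WHAT THIS IS NOT: no instantiation to two-step strategies, no contraction; separation NOT moved.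
-/

namespace Summit.QuantumAdvantage.AdviceFreeQNC0.LocalEngine

open Finset Classical

section Markov

variable {St : Type*} [Fintype St] [DecidableEq St]

/-- Fibrewise count: if every state has at most two preimages under `(σ, b) ↦ δ σ b`, then
`Σ_σ (g (δ σ 0) + g (δ σ 1)) ≤ 2 Σ_σ g σ` for nonnegative `g`. -/
theorem sum_comp_le_two_mul (δ : St → Bool → St)
    (hδ : ∀ σ' : St, ((univ : Finset (St × Bool)).filter fun q => δ q.1 q.2 = σ').card ≤ 2)
    (g : St → ℝ) (hg : ∀ σ, 0 ≤ g σ) :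
    ∑ σ, (g (δ σ false) + g (δ σ true)) ≤ 2 * ∑ σ, g σ := by
  have e1 : ∑ σ, (g (δ σ false) + g (δ σ true)) = ∑ q : St × Bool, g (δ q.1 q.2) := by
    rw [Fintype.sum_prod_type]
    refine Finset.sum_congr rfl fun σ _ => ?_
    rw [Fintype.sum_bool, add_comm]
  have e2 : ∑ q : St × Bool, g (δ q.1 q.2)
      = ∑ σ' : St, (((univ : Finset (St × Bool)).filter fun q => δ q.1 q.2 = σ').card : ℝ) * g σ' := by
    rw [← Finset.sum_fiberwise_of_maps_to (s := (univ : Finset (St × Bool))) (t := (univ : Finset St))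
      (g := fun q : St × Bool => δ q.1 q.2) (fun q _ => Finset.mem_univ _)]
    refine Finset.sum_congr rfl fun σ' _ => ?_
    have hc : ∀ q ∈ (univ : Finset (St × Bool)).filter (fun q => δ q.1 q.2 = σ'), g (δ q.1 q.2) = g σ' := by
      intro q hq; rw [Finset.mem_filter] at hq; rw [hq.2]
    rw [Finset.sum_congr rfl hc, Finset.sum_const, nsmul_eq_mul]
  rw [e1, e2, Finset.mul_sum]
  refine Finset.sum_le_sum fun σ' _ => ?_
  have h := hδ σ'
  have hc : (((univ : Finset (St × Bool)).filter fun q => δ q.1 q.2 = σ').card : ℝ) ≤ 2 := by exact_mod_cast h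
  exact mul_le_mul_of_nonneg_right hc (hg σ')

/-- **One signed step is an `ℓ²`-nonexpansion for a merging automaton** (every state has at most two preimages; weights bounded by `1`). -/
theorem sumSq_stepOp_le_of_fiber (δ : St → Bool → St) (s : St → Bool → ℝ)
    (hδ : ∀ σ' : St, ((univ : Finset (St × Bool)).filter fun q => δ q.1 q.2 = σ').card ≤ 2)
    (hs : ∀ σ b, |s σ b| ≤ 1) (f : St → ℝ) :
    sumSq (stepOp δ s f) ≤ sumSq f := by
  have h1 : ∀ σ, (stepOp δ s f σ) ^ 2 ≤ ((f (δ σ false)) ^ 2 + (f (δ σ true)) ^ 2) / 2 := by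
    intro σ
    unfold stepOp
    have ha2 : (s σ false) ^ 2 ≤ 1 := by have := abs_le.mp (hs σ false); nlinarith
    have hb2 : (s σ true) ^ 2 ≤ 1 := by have := abs_le.mp (hs σ true); nlinarith
    nlinarith [sq_nonneg (s σ false * f (δ σ false) - s σ true * f (δ σ true)),
      mul_nonneg (sub_nonneg.mpr ha2) (sq_nonneg (f (δ σ false))),
      mul_nonneg (sub_nonneg.mpr hb2) (sq_nonneg (f (δ σ true)))]
  have h2 := sum_comp_le_two_mul δ hδ (fun σ => (f σ) ^ 2) (fun σ => sq_nonneg _)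
  calc sumSq (stepOp δ s f) = ∑ σ, (stepOp δ s f σ) ^ 2 := rfl
    _ ≤ ∑ σ, ((f (δ σ false)) ^ 2 + (f (δ σ true)) ^ 2) / 2 := Finset.sum_le_sum fun σ _ => h1 σ
    _ = (∑ σ, ((f (δ σ false)) ^ 2 + (f (δ σ true)) ^ 2)) / 2 := by rw [Finset.sum_div]
    _ ≤ (2 * ∑ σ, (f σ) ^ 2) / 2 := by linarith
    _ = sumSq f := by unfold sumSq; ring

/-- **Every run of a merging automaton is an `ℓ²`-nonexpansion.** -/
theorem sumSq_runOps_le_of_fiber (δ : ℕ → St → Bool → St) (s : ℕ → St → Bool → ℝ)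
    (hδ : ∀ t (σ' : St), ((univ : Finset (St × Bool)).filter fun q => δ t q.1 q.2 = σ').card ≤ 2)
    (hs : ∀ t σ b, |s t σ b| ≤ 1) :
    ∀ (m t : ℕ) (φ : St → ℝ), sumSq (runOps δ s t m φ) ≤ sumSq φ
  | 0, t, φ => le_rfl
  | m + 1, t, φ => by
      rw [runOps_succ]
      exact (sumSq_stepOp_le_of_fiber (δ t) (s t) (hδ t) (hs t) _).trans (sumSq_runOps_le_of_fiber δ s hδ hs m (t + 1) φ)

/-- **Cube-sum bound for a merging automaton**: `|Σ_u pathVal| ≤ 2^m · √(Σ φ²)`. -/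
theorem abs_sum_pathVal_le_of_fiber (δ : ℕ → St → Bool → St) (s : ℕ → St → Bool → ℝ)
    (hδ : ∀ t (σ' : St), ((univ : Finset (St × Bool)).filter fun q => δ t q.1 q.2 = σ').card ≤ 2)
    (hs : ∀ t σ b, |s t σ b| ≤ 1) (m t : ℕ) (σ : St) (φ : St → ℝ) :
    |∑ u : Fin m → Bool, pathVal δ s t m σ u φ| ≤ (2 : ℝ) ^ m * Real.sqrt (sumSq φ) := by
  rw [sum_pathVal_eq, abs_mul, abs_of_nonneg (by positivity : (0 : ℝ) ≤ (2 : ℝ) ^ m)]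
  refine mul_le_mul_of_nonneg_left ?_ (by positivity)
  have h := (sq_apply_le_sumSq' (runOps δ s t m φ) σ).trans (sumSq_runOps_le_of_fiber δ s hδ hs m t φ)
  rw [← Real.sqrt_sq_eq_abs]
  exact Real.sqrt_le_sqrt h

end Markov

section Bias

variable {α : Type*}

/-- **Sign-sum form of the bias**: `2·#{u ∈ Q : f u} − #Q = −Σ_{u ∈ Q} (−1)^{[f u]}` (as reals; `(−1)^{[f u]} = 1 − 2[f u]`). -/
theorem two_mul_card_filter_sub (Q : Finset α) (f : α → Bool) :
    2 * ((Q.filter fun u => f u = true).card : ℝ) - (Q.card : ℝ) = -∑ u ∈ Q, (if f u = true then (-1 : ℝ) else 1) := by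
  rw [Finset.card_filter, Finset.card_eq_sum_ones Q]
  push_cast
  rw [Finset.mul_sum, ← Finset.sum_sub_distrib, ← Finset.sum_neg_distrib]
  refine Finset.sum_congr rfl fun u _ => ?_
  by_cases h : f u = true
  · simp [h]; norm_num
  · simp [h]

/-- Hence `|#{u ∈ Q : f u} − #Q/2| = ½ |Σ_{u ∈ Q} (−1)^{[f u]}|`. -/
theorem abs_card_filter_sub_half_eq (Q : Finset α) (f : α → Bool) :
    |((Q.filter fun u => f u = true).card : ℝ) - (Q.card : ℝ) / 2| = |∑ u ∈ Q, (if f u = true then (-1 : ℝ) else 1)| / 2 := by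
  have h := two_mul_card_filter_sub Q f
  have e : ((Q.filter fun u => f u = true).card : ℝ) - (Q.card : ℝ) / 2
      = -(∑ u ∈ Q, (if f u = true then (-1 : ℝ) else 1)) / 2 := by linarith
  rw [e, abs_div, abs_neg, abs_of_pos (by norm_num : (0 : ℝ) < 2)]

end Bias

end Summit.QuantumAdvantage.AdviceFreeQNC0.LocalEngine
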